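import Summits.NavierStokesRegularity.NavierStokesRegularity.Theorems.PalasekTowerBreakdownEpisodeBaseSuperposedFreeRun
import Summits.NavierStokesRegularity.FluidComputer.PalasekTowerGermHostTameCarrierRun
import Summits.NavierStokesRegularity.FluidComputer.PalasekTowerGermHostPotentialAmplifier
import Summits.NavierStokesRegularity.FluidComputer.PalasekTowerGermHostApproximantFreeRun
import Summits.NavierStokesRegularity.FluidComputer.PalasekTowerGermHostPotentialTruncation

/-!
# `EpisodeBase` (crux stmt-NavierStokesRegularity-19179) from ONE FREE RUN OF A MECHANISM DATUM ALONE —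
# the carrier obligation of the superposition door DISCHARGED (by name)

Cell `ns-blowup`, seat `ns-blowup-ecbridge-3` (g8; D-0074 GROUP C «BRIDGE SUPPORT», lineage `host_preparation`).
Route `PalasekTowerBreakdown`, crux `EpisodeBase`, line `slot`. LABEL: E–C typing (KERNEL: theorems only;
`--supports` stmt-NavierStokesRegularity-19179). WHAT THIS IS NOT: not Navier–Stokes evidence — no free run
meeting the first-window letter is exhibited; nothing about `RungG 1` or blow-up is asserted.

The superposition door of g7 (`palasekTowerBreakdown_episodeBase_of_superposed_freeRuns`, p512842) reduced
the crux to TWO free runs: (i) ONE classical finite-energy free Navier–Stokes run (`ν = 1`) of a smooth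
compactly supported divergence-free MECHANISM datum `W` of speed `< Y₀` which, at `Host.τfirst`, shows near
`W` the three level-`1` faces (speed `≥ Y₁ + η`, gradient `≥ A₁ + η`, an `N₁`-core loop of circulation
`≥ N₁^{β−2} + η`) while staying under the cap `(5/3)Y₁ − η`; and (ii) ONE tame free run of SOME strict-slot
carrier under the same cap. This file removes (ii): by `Germ.exists_levelZeroData_tame_freeRun_cap`
(FluidComputer, this seat — the TAME CARRIER `tinyProfile a + λ • farPusher` of `L³` size below Kato's
threshold fills the strict slot, and Kato's small-data theory with Leray's short-time bound,
`Literature.Analysis.FluidPDE.exists_classical_run_norm_le_two_mul_Icc`, runs it classically under `2Y₀ ≤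
(4/3)Y₁` on the whole window) the carrier half is a THEOREM for every margin `η ≤ Y₁/3`, and `η ≤ Y₁/3` is
forced by (i) itself (`Germ.margin_le_third`). Hence, BY NAME:

* `palasekTowerBreakdown_episodeBase_of_mechanism_freeRun` — (i) alone ⟹ `EpisodeBase`;
* `palasekTowerBreakdown_episodeBase_of_curl_mechanism_freeRun` — `W = curl A`, `A ∈ C_c^∞`, `‖DA‖ ≤ L`,
  `4L < Y₀` (every static condition closed-form);
* `palasekTowerBreakdown_episodeBase_of_approximable_mechanism_freeRun` — `W` Schwartz with compactly
  supported speed-`< Y₀` approximants at every sup distance (the approximable door, p516522, carrier-free);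
* `palasekTowerBreakdown_episodeBase_of_schwartz_potential_mechanism_freeRun` — `W = curl A`, `A` a smooth
  Schwartz potential with `‖DA‖ ≤ L`, `4L < Y₀` (truncation inside the kernel, p517677).

So the crux's MODEL-facing letter is now EXACTLY the 𝔄-witness: ONE free classical finite-energy
Navier–Stokes run of a speed-`< Y₀` divergence-free datum reaching the three level-`1` faces with a margin
near it under the cap. References: S. Palasek, arXiv:2605.13827 §4 [cite: Palasek2026ElementaryModel, §4];
T. Kato, Math. Z. 187 (1984), Thm. 2–4 [cite: Kato1984, Thm. 2–4]; T. Tao, Anal. PDE 6 (2013), Thm. 5.4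
[cite: Tao2011, Thm. 5.4 (ii)+(iv)].
-/

noncomputable section

-- `Summit.<Summit>.<Problem>` is the tree's mandated summit-side namespace (CONVENTIONS §2); for this
-- single-conjunct summit the two coincide, so the duplicate is deliberate.
set_option linter.dupNamespace false

namespace Summit.NavierStokesRegularity.NavierStokesRegularity.Theorems

open Set Function MeasureTheory Metric
open scoped ENNReal ContDiff
open Summit.NavierStokesRegularity.NavierStokesRegularity.Theses
open Summit.NavierStokesRegularity.FluidComputer.PalasekTowerClayBridge
open Summit.NavierStokesRegularity.FluidComputer.PalasekTowerClayBridge.Germ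
open Literature.Analysis.FluidPDE

/-- **`EpisodeBase` FROM ONE FREE RUN OF A MECHANISM DATUM.** Let `W : ℝ³ → ℝ³` be smooth, divergence
free, `tsupport W ⊆ B̄(0, R)` (`R ≥ 0`), of speed `< Y₀`, with ONE classical finite-energy free
Navier–Stokes run `(v₂, q₂)` (`ν = 1`) on `[1, Host.τfirst]` from `v₂ 1 = W` staying below `(5/3) Y₁ − η`
(`η > 0`) and showing at `Host.τfirst`, inside `‖x‖ ≤ R`: `Y₁ + η ≤ ‖v₂‖`, `A₁ + η ≤ ‖Dv₂‖`, and an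
`N₁`-core loop of circulation `≥ N₁^{β−2} + η`. Then `EpisodeBase`: the margin is `≤ Y₁/3`
(`margin_le_third`), a tame carrier run under the cap exists (`exists_levelZeroData_tame_freeRun_cap`:
Kato small data + Leray short time), and the superposition door closes the crux.
[cite: Palasek2026ElementaryModel, §4] [cite: Kato1984, Thm. 2–4] [cite: Tao2011, Thm. 5.4 (ii)+(iv)] -/
theorem palasekTowerBreakdown_episodeBase_of_mechanism_freeRun
    {W : EuclideanSpace ℝ (Fin 3) → EuclideanSpace ℝ (Fin 3)} {R : ℝ}
    (hW : ContDiff ℝ ∞ W) (hdivW : VectorCalculus.IsDivFree W) (hWsupp : tsupport W ⊆ closedBall 0 R)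
    (hWlt : ∀ x, ‖W x‖ < TowerRates.wide.Y 0) (hR : 0 ≤ R)
    {v₂ : ℝ → EuclideanSpace ℝ (Fin 3) → EuclideanSpace ℝ (Fin 3)} {q₂ : ℝ → EuclideanSpace ℝ (Fin 3) → ℝ}
    (hv₂ : IsClassicalNSSolutionOn (Icc 1 Host.τfirst) 1 0 v₂ q₂) (hv₂1 : v₂ 1 = W)
    (hv₂E : ∃ C : ℝ≥0∞, C < ⊤ ∧ ∀ t ∈ Icc (1 : ℝ) Host.τfirst, ∫⁻ x, ‖v₂ t x‖ₑ ^ 2 ≤ C)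
    {η : ℝ} (hη : 0 < η)
    (hcap₂ : ∀ t ∈ Icc (1 : ℝ) Host.τfirst, ∀ x, ‖v₂ t x‖ ≤ 5 / 3 * TowerRates.wide.Y 1 - η)
    (hspeed : ∃ x, ‖x‖ ≤ R ∧ TowerRates.wide.Y 1 + η ≤ ‖v₂ Host.τfirst x‖)
    (hstrain : ∃ x, ‖x‖ ≤ R ∧ TowerRates.wide.A 1 + η ≤ ‖fderiv ℝ (v₂ Host.τfirst) x‖)
    (hcore : ∃ (x : EuclideanSpace ℝ (Fin 3)) (γ : ℝ → EuclideanSpace ℝ (Fin 3)),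
      ‖x‖ ≤ R ∧ ContDiff ℝ 1 γ ∧ γ 0 = γ 1 ∧
      (∀ s ∈ Icc (0 : ℝ) 1, γ s ∈ closedBall x (1 / TowerRates.wide.N 1)) ∧
      (∀ s ∈ Icc (0 : ℝ) 1, ‖deriv γ s‖ ≤ 8 * Real.pi / TowerRates.wide.N 1) ∧
      TowerRates.wide.N 1 ^ (TowerRates.wide.β - 2) + η ≤ circulation (v₂ Host.τfirst) γ) :
    PalasekTowerBreakdown.EpisodeBase := by
  have hτ : Host.τfirst ∈ Icc (1 : ℝ) Host.τfirst := ⟨one_lt_τfirst.le, le_rfl⟩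
  have hη3 : η ≤ TowerRates.wide.Y 1 / 3 :=
    margin_le_third (hspeed.imp fun x hx => hx.2) (hcap₂ Host.τfirst hτ)
  obtain ⟨U, hLZ, v, q, hv, hv1, hE, hcap₁⟩ := exists_levelZeroData_tame_freeRun_cap hη3
  exact palasekTowerBreakdown_episodeBase_of_superposed_freeRuns hLZ hW hdivW hWsupp hWlt hR hv hv1 hE hv₂
    hv₂1 hv₂E hη hcap₁ hcap₂ hspeed hstrain hcore

/-- **`EpisodeBase` FROM ONE FREE RUN OF THE CURL OF A COMPACTLY SUPPORTED POTENTIAL.** `A ∈ C^∞`,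
`tsupport A ⊆ B̄(0, R)` (`R ≥ 0`), `‖DA(x)‖ ≤ L`, `4L < Y₀`; ONE classical finite-energy free run of
`curl A` on `[1, Host.τfirst]` below `(5/3) Y₁ − η` showing the three level-`1` faces with margin `η > 0`
inside `‖x‖ ≤ R` ⟹ `EpisodeBase` (every static condition on the datum is closed-form).
[cite: Palasek2026ElementaryModel, §4] [cite: MajdaBertozziCUP2002, §1.1 (1.11)] -/
theorem palasekTowerBreakdown_episodeBase_of_curl_mechanism_freeRun
    {A : EuclideanSpace ℝ (Fin 3) → EuclideanSpace ℝ (Fin 3)} {R L : ℝ}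
    (hA : ContDiff ℝ ∞ A) (hAsupp : tsupport A ⊆ closedBall 0 R) (hR : 0 ≤ R)
    (hL : ∀ x, ‖fderiv ℝ A x‖ ≤ L) (h4L : 4 * L < TowerRates.wide.Y 0)
    {v₂ : ℝ → EuclideanSpace ℝ (Fin 3) → EuclideanSpace ℝ (Fin 3)} {q₂ : ℝ → EuclideanSpace ℝ (Fin 3) → ℝ}
    (hv₂ : IsClassicalNSSolutionOn (Icc 1 Host.τfirst) 1 0 v₂ q₂) (hv₂1 : v₂ 1 = curl A)
    (hv₂E : ∃ C : ℝ≥0∞, C < ⊤ ∧ ∀ t ∈ Icc (1 : ℝ) Host.τfirst, ∫⁻ x, ‖v₂ t x‖ₑ ^ 2 ≤ C)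
    {η : ℝ} (hη : 0 < η)
    (hcap₂ : ∀ t ∈ Icc (1 : ℝ) Host.τfirst, ∀ x, ‖v₂ t x‖ ≤ 5 / 3 * TowerRates.wide.Y 1 - η)
    (hspeed : ∃ x, ‖x‖ ≤ R ∧ TowerRates.wide.Y 1 + η ≤ ‖v₂ Host.τfirst x‖)
    (hstrain : ∃ x, ‖x‖ ≤ R ∧ TowerRates.wide.A 1 + η ≤ ‖fderiv ℝ (v₂ Host.τfirst) x‖)
    (hcore : ∃ (x : EuclideanSpace ℝ (Fin 3)) (γ : ℝ → EuclideanSpace ℝ (Fin 3)),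
      ‖x‖ ≤ R ∧ ContDiff ℝ 1 γ ∧ γ 0 = γ 1 ∧
      (∀ s ∈ Icc (0 : ℝ) 1, γ s ∈ closedBall x (1 / TowerRates.wide.N 1)) ∧
      (∀ s ∈ Icc (0 : ℝ) 1, ‖deriv γ s‖ ≤ 8 * Real.pi / TowerRates.wide.N 1) ∧
      TowerRates.wide.N 1 ^ (TowerRates.wide.β - 2) + η ≤ circulation (v₂ Host.τfirst) γ) :
    PalasekTowerBreakdown.EpisodeBase :=
  palasekTowerBreakdown_episodeBase_of_mechanism_freeRun (contDiff_curl_top hA) (isDivFree_curl hA)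
    (tsupport_curl_subset hAsupp) (fun x => (norm_curl_le_of_fderiv_le hL x).trans_lt h4L) hR hv₂ hv₂1 hv₂E
    hη hcap₂ hspeed hstrain hcore

/-- **`EpisodeBase` FROM ONE FREE RUN OF A SCHWARTZ MECHANISM DATUM WITH COMPACT APPROXIMANTS.** `W`
Schwartz (`HasRapidSpatialDecay W`) with ONE classical finite-energy free run on `[1, Host.τfirst]` below
`(5/3) Y₁ − η` showing the three level-`1` faces with margin `η > 0` inside `‖x‖ ≤ R` (`R ≥ 0`), and, at
every sup distance `δ > 0`, a smooth divergence-free approximant `W'` with `tsupport W' ⊆ B̄(0, R')`,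
`R ≤ R'`, speed `< Y₀` ⟹ `EpisodeBase` (the approximable door `Germ.exists_compact_approximant_freeRun`
supplies a compactly supported datum whose free run meets the letter with margin `η/2`).
[cite: Palasek2026ElementaryModel, §4] [cite: Tao2011, Thm. 5.4 (ii)+(iv)] -/
theorem palasekTowerBreakdown_episodeBase_of_approximable_mechanism_freeRun
    {W : EuclideanSpace ℝ (Fin 3) → EuclideanSpace ℝ (Fin 3)} {R : ℝ} (hW0 : HasRapidSpatialDecay W)
    (hR : 0 ≤ R)
    {v₂ : ℝ → EuclideanSpace ℝ (Fin 3) → EuclideanSpace ℝ (Fin 3)} {q₂ : ℝ → EuclideanSpace ℝ (Fin 3) → ℝ}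
    (hv₂ : IsClassicalNSSolutionOn (Icc 1 Host.τfirst) 1 0 v₂ q₂) (hv₂1 : v₂ 1 = W)
    (hv₂E : ∃ C : ℝ≥0∞, C < ⊤ ∧ ∀ t ∈ Icc (1 : ℝ) Host.τfirst, ∫⁻ x, ‖v₂ t x‖ₑ ^ 2 ≤ C)
    {η : ℝ} (hη : 0 < η)
    (hcap₂ : ∀ t ∈ Icc (1 : ℝ) Host.τfirst, ∀ x, ‖v₂ t x‖ ≤ 5 / 3 * TowerRates.wide.Y 1 - η)
    (hspeed : ∃ x, ‖x‖ ≤ R ∧ TowerRates.wide.Y 1 + η ≤ ‖v₂ Host.τfirst x‖)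
    (hstrain : ∃ x, ‖x‖ ≤ R ∧ TowerRates.wide.A 1 + η ≤ ‖fderiv ℝ (v₂ Host.τfirst) x‖)
    (hcore : ∃ (x : EuclideanSpace ℝ (Fin 3)) (γ : ℝ → EuclideanSpace ℝ (Fin 3)),
      ‖x‖ ≤ R ∧ ContDiff ℝ 1 γ ∧ γ 0 = γ 1 ∧
      (∀ s ∈ Icc (0 : ℝ) 1, γ s ∈ closedBall x (1 / TowerRates.wide.N 1)) ∧
      (∀ s ∈ Icc (0 : ℝ) 1, ‖deriv γ s‖ ≤ 8 * Real.pi / TowerRates.wide.N 1) ∧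
      TowerRates.wide.N 1 ^ (TowerRates.wide.β - 2) + η ≤ circulation (v₂ Host.τfirst) γ)
    (happrox : ∀ δ : ℝ, 0 < δ → ∃ (W' : EuclideanSpace ℝ (Fin 3) → EuclideanSpace ℝ (Fin 3)) (R' : ℝ),
      ContDiff ℝ ∞ W' ∧ VectorCalculus.IsDivFree W' ∧ tsupport W' ⊆ closedBall 0 R' ∧
      (∀ x, ‖W' x‖ < TowerRates.wide.Y 0) ∧ R ≤ R' ∧ ∀ x, ‖W' x - W x‖ ≤ δ) :
    PalasekTowerBreakdown.EpisodeBase := by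
  obtain ⟨W', R', u, p, hW', hdivW', hW'supp, hW'lt, hR', hu, hu1, huE, hcap, hsp, hst, hco⟩ :=
    exists_compact_approximant_freeRun hW0 hR hv₂ hv₂1 hv₂E hη hcap₂ hspeed hstrain hcore happrox
  exact palasekTowerBreakdown_episodeBase_of_mechanism_freeRun hW' hdivW' hW'supp hW'lt hR' hu hu1
    huE (half_pos hη) hcap hsp hst hco

/-- **`EpisodeBase` FROM ONE FREE RUN OF THE CURL OF A SCHWARTZ POTENTIAL.** `A` smooth and Schwartz
(`HasRapidSpatialDecay A`) with `‖DA(x)‖ ≤ L`, `4L < Y₀`, `R ≥ 0`; ONE classical finite-energy free run of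
`curl A` on `[1, Host.τfirst]` below `(5/3) Y₁ − η` showing the three level-`1` faces with margin `η > 0`
inside `‖x‖ ≤ R` ⟹ `EpisodeBase` (the truncations `curl(χ_ρ A)` are the compact approximants,
`exists_compact_truncation_curl`). [cite: Palasek2026ElementaryModel, §4] [cite: MajdaBertozziCUP2002, §1.1 (1.11)] -/
theorem palasekTowerBreakdown_episodeBase_of_schwartz_potential_mechanism_freeRun
    {A : EuclideanSpace ℝ (Fin 3) → EuclideanSpace ℝ (Fin 3)} {R L : ℝ}
    (hA : ContDiff ℝ ∞ A) (hAdec : HasRapidSpatialDecay A) (hL : ∀ x, ‖fderiv ℝ A x‖ ≤ L)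
    (h4L : 4 * L < TowerRates.wide.Y 0) (hR : 0 ≤ R)
    {v₂ : ℝ → EuclideanSpace ℝ (Fin 3) → EuclideanSpace ℝ (Fin 3)} {q₂ : ℝ → EuclideanSpace ℝ (Fin 3) → ℝ}
    (hv₂ : IsClassicalNSSolutionOn (Icc 1 Host.τfirst) 1 0 v₂ q₂) (hv₂1 : v₂ 1 = curl A)
    (hv₂E : ∃ C : ℝ≥0∞, C < ⊤ ∧ ∀ t ∈ Icc (1 : ℝ) Host.τfirst, ∫⁻ x, ‖v₂ t x‖ₑ ^ 2 ≤ C)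
    {η : ℝ} (hη : 0 < η)
    (hcap₂ : ∀ t ∈ Icc (1 : ℝ) Host.τfirst, ∀ x, ‖v₂ t x‖ ≤ 5 / 3 * TowerRates.wide.Y 1 - η)
    (hspeed : ∃ x, ‖x‖ ≤ R ∧ TowerRates.wide.Y 1 + η ≤ ‖v₂ Host.τfirst x‖)
    (hstrain : ∃ x, ‖x‖ ≤ R ∧ TowerRates.wide.A 1 + η ≤ ‖fderiv ℝ (v₂ Host.τfirst) x‖)
    (hcore : ∃ (x : EuclideanSpace ℝ (Fin 3)) (γ : ℝ → EuclideanSpace ℝ (Fin 3)),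
      ‖x‖ ≤ R ∧ ContDiff ℝ 1 γ ∧ γ 0 = γ 1 ∧
      (∀ s ∈ Icc (0 : ℝ) 1, γ s ∈ closedBall x (1 / TowerRates.wide.N 1)) ∧
      (∀ s ∈ Icc (0 : ℝ) 1, ‖deriv γ s‖ ≤ 8 * Real.pi / TowerRates.wide.N 1) ∧
      TowerRates.wide.N 1 ^ (TowerRates.wide.β - 2) + η ≤ circulation (v₂ Host.τfirst) γ) :
    PalasekTowerBreakdown.EpisodeBase :=
  palasekTowerBreakdown_episodeBase_of_approximable_mechanism_freeRun (hasRapidSpatialDecay_curl hA hAdec) hR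
    hv₂ hv₂1 hv₂E hη hcap₂ hspeed hstrain hcore
    (fun _ hδ => exists_compact_truncation_curl hA hAdec hL h4L R hδ)

end Summit.NavierStokesRegularity.NavierStokesRegularity.Theorems

end
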